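import Summits.NavierStokesRegularity.NavierStokesRegularity.Theorems.AdaptedFrequencyTangentFlowTransferWindowExtraction
import Literature.Analysis.FluidPDE.VorticityCalculus
import Literature.Analysis.FluidPDE.Vorticity
import HarnessLib

/-!
# Route `ScaledTopAlignment`, crux W3ᵐᵗ = `AprioriMostTimesBulkAlignment` (stmt-NavierStokesRegularity-19551):
# `C²_loc` tools for the Type-I profile class — Hessian compactness and convergence of `∇ξ`

Two tools for the BUDGET form of the planner's SPLIT-9 rung Q(C) (`ScaledTopAlignmentTypeIProfileUniformBudgetDecoherence`),
whose density `|ω|^{3/2} ‖∇ξ‖²` (`ξ = ω/|ω|`) involves SECOND derivatives of the velocity: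

* `exists_tendsto_hessian_of_isTypeIAncientMild_seq` — `C²_loc` compactness of the zoom-limit class
  `IsTypeIAncientMild C`: along a subsequence, slices, gradients AND Hessians converge locally uniformly at every
  `t < 0` to those of a field of the same class (the tree's windowed extraction
  `exists_tendsto_of_typeI_oseenMild_windows`, KNSS 2009 Prop. 4.1 / Lemma 6.1, read on the windows `(−(k+1), 0)`;
  the first-order version is `exists_tendsto_of_isTypeIAncientMild_seq`);
* `contDiff_curl_slice_of_isTypeIAncientMild` — the vorticity of every slice of a field of the class is `C^∞`;
* `tendsto_fderiv_vorticityDirection` — if `ω_i(y) → Ω(y) ≠ 0` and `Dω_i(y) → DΩ(y)` then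
  `D(ω_i/|ω_i|)(y) → D(Ω/|Ω|)(y)` (chain rule through the normalisation `v ↦ v/|v|`, `C¹` off the origin, and
  continuity of composition of continuous linear maps);
* `measurable_budgetDensity` — the budget density `|ω|^{3/2} ‖D(ω/|ω|)‖²` of a continuous field is measurable
  (`measurable_fderiv`).

WHAT THIS IS NOT: not NS regularity; soft compactness/calculus lemmas about the (possibly trivial) class of Type-I
ancient mild profiles, no statement about blow-up. [folklore]
-/

noncomputable section

-- the summit and its single sub-problem share the name (CONVENTIONS §1), as in every Theorems file
set_option linter.dupNamespace false

open Set Function Filter Topology Metric MeasureTheory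
open scoped ENNReal
open Literature.Analysis Literature.Analysis.FluidPDE

namespace Summit.NavierStokesRegularity.NavierStokesRegularity.Theorems

/-! ### `C²_loc` compactness of the Type-I class -/

/-- **`C²_loc` compactness of `IsTypeIAncientMild C`.** Along a subsequence, the slices of a sequence of
Type-I ancient mild fields with a common constant, their gradients AND their second derivatives converge
locally uniformly, at every `t < 0`, to those of a field of the same class (the tree's windowed extraction
`exists_tendsto_of_typeI_oseenMild_windows` on the windows `(−(k+1), 0)`). [cite: KochNadirashviliSereginSverak2009, Prop. 4.1 and Lemma 6.1 (arXiv:0709.3599 pp. 8, 11)] -/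
theorem exists_tendsto_hessian_of_isTypeIAncientMild_seq (C : ℝ)
    {w : ℕ → ℝ → EuclideanSpace ℝ (Fin 3) → EuclideanSpace ℝ (Fin 3)}
    (hw : ∀ k, IsTypeIAncientMild C (w k)) :
    ∃ φ : ℕ → ℕ, StrictMono φ ∧
      ∃ W : ℝ → EuclideanSpace ℝ (Fin 3) → EuclideanSpace ℝ (Fin 3), IsTypeIAncientMild C W ∧
        (∀ t < 0, TendstoLocallyUniformly (fun j => w (φ j) t) (W t) atTop) ∧
        (∀ t < 0, TendstoLocallyUniformly (fun j => fderiv ℝ (w (φ j) t)) (fderiv ℝ (W t)) atTop) ∧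
        (∀ t < 0, TendstoLocallyUniformly (fun j => fderiv ℝ (fderiv ℝ (w (φ j) t)))
          (fderiv ℝ (fderiv ℝ (W t))) atTop) := by
  set A : ℕ → ℝ := fun k => -((k : ℝ) + 1) with hA
  have hAt : Tendsto A atTop atBot :=
    tendsto_neg_atTop_atBot.comp (tendsto_atTop_add_const_right _ _ tendsto_natCast_atTop_atTop)
  have hC : 0 ≤ C := (hw 0).nonneg
  refine exists_tendsto_of_typeI_oseenMild_windows hC hAt (w := w) (fun k => ?_) (fun k t ht => ?_)
    (fun k s t _ hst ht x => (hw k).mild_eq_heatExtension hst ht x) (fun k t ht x => (hw k).norm_le ht.2 x)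
  · exact (hw k).continuousOn_uncurry.mono (prod_mono (fun t ht => ht.2) subset_rfl)
  · exact (hw k).isWeaklyDivFree ht.2

/-- The vorticity `curl (u t)` of every slice `t < 0` of a Type-I ancient mild field is `C^∞` (the slice is `C^∞`,
`curl = curlCLM ∘ D`). [folklore] -/
theorem contDiff_curl_slice_of_isTypeIAncientMild {C : ℝ}
    {u : ℝ → EuclideanSpace ℝ (Fin 3) → EuclideanSpace ℝ (Fin 3)} (h : IsTypeIAncientMild C u) {t : ℝ}
    (ht : t < 0) : ContDiff ℝ (⊤ : ℕ∞) (curl (u t)) :=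
  contDiff_curl (n := ⊤) (by exact_mod_cast h.contDiff_slice ht)

/-- The budget density `|ω|^{3/2} ‖D(ω/|ω|)‖²` (as an `ℝ≥0∞`-valued function) of a continuous field is measurable
(the Fréchet derivative of any map is measurable, `measurable_fderiv`). [folklore] -/
theorem measurable_budgetDensity {ω : EuclideanSpace ℝ (Fin 3) → EuclideanSpace ℝ (Fin 3)} (hω : Continuous ω) :
    Measurable fun y => ENNReal.ofReal (‖ω y‖ ^ (3 / 2 : ℝ) * ‖fderiv ℝ (vorticityDirection ω) y‖ ^ 2) :=
  ENNReal.measurable_ofReal.comp ((hω.measurable.norm.pow_const _).mul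
    ((measurable_fderiv ℝ (vorticityDirection ω)).norm.pow_const _))

/-! ### Convergence of the derivative of the direction field -/

/-- **The derivative of the direction field converges.** If `ω_i → Ω` and `Dω_i → DΩ` at a point `y` with
`Ω y ≠ 0` (each `ω_i` and `Ω` differentiable at `y`), then `D(ω_i/|ω_i|)(y) → D(Ω/|Ω|)(y)`: chain rule
through the normalisation map `v ↦ v/|v|`, which is `C¹` off the origin. [folklore] -/
theorem tendsto_fderiv_vorticityDirection {ι : Type*} {l : Filter ι}
    {ω : ι → EuclideanSpace ℝ (Fin 3) → EuclideanSpace ℝ (Fin 3)}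
    {Ω : EuclideanSpace ℝ (Fin 3) → EuclideanSpace ℝ (Fin 3)} {y : EuclideanSpace ℝ (Fin 3)}
    (hd : ∀ i, DifferentiableAt ℝ (ω i) y) (hD : DifferentiableAt ℝ Ω y) (hy : Ω y ≠ 0)
    (h0 : Tendsto (fun i => ω i y) l (𝓝 (Ω y)))
    (h1 : Tendsto (fun i => fderiv ℝ (ω i) y) l (𝓝 (fderiv ℝ Ω y))) :
    Tendsto (fun i => fderiv ℝ (vorticityDirection (ω i)) y) l
      (𝓝 (fderiv ℝ (vorticityDirection Ω) y)) := by
  set N : EuclideanSpace ℝ (Fin 3) → EuclideanSpace ℝ (Fin 3) := fun v => ‖v‖⁻¹ • v with hN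
  have hNc : ∀ v : EuclideanSpace ℝ (Fin 3), v ≠ 0 → ContDiffAt ℝ 1 N v := fun v hv =>
    ((contDiffAt_id.norm ℝ hv).inv (norm_ne_zero_iff.2 hv)).smul contDiffAt_id
  have hcomp : ∀ (v : EuclideanSpace ℝ (Fin 3) → EuclideanSpace ℝ (Fin 3)),
      DifferentiableAt ℝ v y → v y ≠ 0 →
      fderiv ℝ (vorticityDirection v) y = (fderiv ℝ N (v y)).comp (fderiv ℝ v y) := by
    intro v hv hvy
    have e : vorticityDirection v = N ∘ v := rfl
    rw [e]
    exact fderiv_comp y ((hNc _ hvy).differentiableAt one_ne_zero) hv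
  have hev : ∀ᶠ i in l, ω i y ≠ 0 := h0.eventually_ne hy
  have hN' : Tendsto (fun i => fderiv ℝ N (ω i y)) l (𝓝 (fderiv ℝ N (Ω y))) :=
    (((hNc _ hy).fderiv_right (m := 0) (by norm_num)).continuousAt.tendsto).comp h0
  have hpair : Tendsto (fun i => (fderiv ℝ N (ω i y)).comp (fderiv ℝ (ω i) y)) l
      (𝓝 ((fderiv ℝ N (Ω y)).comp (fderiv ℝ Ω y))) := by
    have hc := ((ContinuousLinearMap.compL ℝ (EuclideanSpace ℝ (Fin 3)) (EuclideanSpace ℝ (Fin 3))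
      (EuclideanSpace ℝ (Fin 3))).continuous₂.tendsto (fderiv ℝ N (Ω y), fderiv ℝ Ω y)).comp
      (hN'.prodMk_nhds h1)
    simpa only [Function.comp_def, Function.uncurry_apply_pair, ContinuousLinearMap.compL_apply] using hc
  rw [hcomp Ω hD hy]
  refine hpair.congr' ?_
  filter_upwards [hev] with i hi
  rw [hcomp (ω i) (hd i) hi]

end Summit.NavierStokesRegularity.NavierStokesRegularity.Theorems

end
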